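import Summits.NavierStokesRegularity.NavierStokesRegularity.Theorems.ScaledTopAlignmentBulkFatou
import Summits.NavierStokesRegularity.NavierStokesRegularity.Theorems.LocalSineTubeDoorProfileAlignedWindowRigidity
import Summits.NavierStokesRegularity.NavierStokesRegularity.Theorems.ClockStretchingLawClockCeilingUnidirectionalVorticityLiouville
import Literature.Analysis.FluidPDE.VorticityCalculus
import HarnessLib
/-!
# Route `ScaledTopAlignment`: GLUE KIT for the window-bulk door W3ʷᵇ (`AprioriWindowBulkAlignment`,
# stmt-NavierStokesRegularity-19447) — importable from the route file (no `Theses.ScaledTopAlignment` import)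
The bridges `ScaledTopAlignment{NearMax,Window,BulkWindow}Bridge.lean` import (through the GAP″ proof) the
route file, so `closes` cannot cite them. This kit re-packages the window-bulk argument WITHOUT that import,
for a `closes` whose zoom crux is stated in PARABOLIC form (the conclusion of
`typeIZoom_ancientMild_limit_parabolic`): `exists_window_cross_eq_zero_of_windowBulkAligned` (W3ʷᵇ at ONE
solution — constants `lam0 < 1`, `R0 > 0`, times `[0,T)`, the per-solution body of stmt-19447 — makes a
parabolic vorticity-zoom limit `Ω` parallel to `Ω y₀` near any `y₀` with `Ω y₀ ≠ 0`) and
**`false_of_windowBulkAligned_parabolicZoom`** (that, plus a non-trivial Type-I ancient mild field whose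
slice vorticities are parabolic vorticity-zoom limits of the solution, is absurd: Giga–Miura's Liouville
`unidirectionalVorticityLiouville` for vorticity-free slices, else LocalSineTubeDoor's
`eq_zero_of_aligned_window`). Glue: `obtain ⟨C, W, hWcl, hW0, hzoom⟩ := hZ …; obtain ⟨lam0, h1, R0, hR0,
hfam⟩ := hW …; exact false_of_windowBulkAligned_parabolicZoom hν hT h1 hR0 hfam hWcl hW0 hzoom`.
WHAT THIS IS NOT: not NS regularity; nothing here proves W3ʷᵇ. References: Giga–Miura, CMP 303 (2011) =
HUPS #956, Thm 1.1, Rmk 1.4, §2.1 [GigaMiura2011]; KNSS, Acta Math. 203 (2009), Thm 5.1, §6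
[KochNadirashviliSereginSverak2009].
-/

noncomputable section
-- the summit and its single sub-problem share the name (CONVENTIONS §1), as in every Theorems file
set_option linter.dupNamespace false
open MeasureTheory Set Function Filter Topology Metric
open scoped RealInnerProductSpace ENNReal
namespace Summit.NavierStokesRegularity.NavierStokesRegularity.Theorems
open Literature.Analysis Literature.Analysis.FluidPDE
open Summit.NavierStokesRegularity.NavierStokesRegularity.Theorems.LocalSineTubeDoorProfileAlignedWindowRigidity

set_option maxHeartbeats 400000 in
/-- The localised Fatou upgrade (same statement and proof as the tree's
`dirSine_limit_eq_zero_near_of_bulkWindowScaledTopAligned` in `ScaledTopAlignmentBulkWindowBridge.lean`, whose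
module imports the route file and therefore cannot be used here; private copy). [folklore] -/
private theorem dirSine_near_eq_zero_aux {ν T : ℝ} (hν : 0 < ν) (hT : 0 < T)
    {ω : ℝ → EuclideanSpace ℝ (Fin 3) → EuclideanSpace ℝ (Fin 3)} {lam₀ R₀ : ℝ} (hlam₀ : 0 < lam₀)
    (hR₀ : 0 < R₀)
    (hW : ∀ κ : ℝ, 0 < κ → ∀ ε : ℝ, 0 < ε → ∀ δ : ℝ, 0 < δ → ∃ M : ℝ, 0 < M ∧ ∀ t ∈ Set.Ioo 0 T,
      ∀ x : EuclideanSpace ℝ (Fin 3), M ≤ ‖ω t x‖ → κ / (T - t) ≤ ‖ω t x‖ →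
        volume {y : EuclideanSpace ℝ (Fin 3) | lam₀ * ‖ω t x‖ ≤ ‖ω t y‖ ∧
            ‖x - y‖ ≤ R₀ * Real.sqrt (ν / ‖ω t x‖) ∧
            ε < Real.sqrt (1 - (inner ℝ (‖ω t x‖⁻¹ • ω t x) (‖ω t y‖⁻¹ • ω t y)) ^ 2)}
          ≤ ENNReal.ofReal (δ * Real.sqrt (ν / ‖ω t x‖) ^ 3))
    {s : ℝ} (hs : s < 0) {xc : ℕ → EuclideanSpace ℝ (Fin 3)} {t : ℕ → ℝ} {lam : ℕ → ℝ}
    {Ω : EuclideanSpace ℝ (Fin 3) → EuclideanSpace ℝ (Fin 3)}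
    (ht : ∀ j, t j ∈ Ico 0 T) (htT : Tendsto t atTop (𝓝 T)) (hlam : ∀ j, 0 < lam j)
    (hlam0 : Tendsto lam atTop (𝓝 0)) (hpar : ∀ j, lam j ^ 2 * (-s) = ν * (T - t j))
    (hΩ : Continuous Ω)
    (hconv : ∀ y, Tendsto (fun j => (lam j ^ 2 / ν) • ω (t j) (xc j + lam j • y)) atTop (𝓝 (Ω y)))
    {y₀ y : EuclideanSpace ℝ (Fin 3)} (hy₀ : Ω y₀ ≠ 0) (hyA : lam₀ * ‖Ω y₀‖ < ‖Ω y‖)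
    (hyρ : ‖y - y₀‖ < R₀ / (2 * Real.sqrt (2 * ‖Ω y₀‖))) :
    Real.sqrt (1 - (inner ℝ (‖Ω y₀‖⁻¹ • Ω y₀) (‖Ω y‖⁻¹ • Ω y)) ^ 2) = 0 := by
  by_contra hs0
  set w : ℕ → EuclideanSpace ℝ (Fin 3) → EuclideanSpace ℝ (Fin 3) :=
    fun j z => (lam j ^ 2 / ν) • ω (t j) (xc j + lam j • z) with hwdef
  have hconv' : ∀ z, Tendsto (fun j => w j z) atTop (𝓝 (Ω z)) := hconv
  set A := ‖Ω y₀‖ with hAdef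
  set B := ‖Ω y‖ with hBdef
  set sn := Real.sqrt (1 - (inner ℝ (‖Ω y₀‖⁻¹ • Ω y₀) (‖Ω y‖⁻¹ • Ω y)) ^ 2) with hsndef
  have hA : 0 < A := norm_pos_iff.mpr hy₀
  have hB : 0 < B := lt_of_le_of_lt (by positivity) hyA
  have hy : Ω y ≠ 0 := norm_pos_iff.mp hB
  have hsn : 0 < sn := lt_of_le_of_ne (dirSine_nonneg _ _) (Ne.symm hs0)
  have hc : ∀ j, 0 < lam j ^ 2 / ν := fun j => div_pos (pow_pos (hlam j) 2) hν
  have hs2A : 0 < Real.sqrt (2 * A) := Real.sqrt_pos.2 (by linarith)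
  set ρ : ℝ := R₀ / (2 * Real.sqrt (2 * A)) with hρ
  have hρle : ρ ≤ R₀ / Real.sqrt (2 * A) := by
    rw [hρ, div_le_div_iff_of_pos_left hR₀ (by positivity) hs2A]
    linarith
  set εS := sn / 2 with hεS
  have hεS0 : 0 < εS := by positivity
  have hnear : ∀ᶠ y' in 𝓝 y, lam₀ * A < ‖Ω y'‖ ∧ ‖y' - y₀‖ < ρ ∧
      εS < Real.sqrt (1 - (inner ℝ (‖Ω y₀‖⁻¹ • Ω y₀) (‖Ω y'‖⁻¹ • Ω y')) ^ 2) := by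
    have hΩy : Tendsto Ω (𝓝 y) (𝓝 (Ω y)) := (hΩ.continuousAt (x := y)).tendsto
    have h1 : Tendsto (fun y' => ‖Ω y'‖) (𝓝 y) (𝓝 B) := hΩy.norm
    have h2 : Tendsto (fun y' => Real.sqrt (1 - (inner ℝ (‖Ω y₀‖⁻¹ • Ω y₀) (‖Ω y'‖⁻¹ • Ω y')) ^ 2))
        (𝓝 y) (𝓝 sn) :=
      tendsto_dirSine hy₀ hy tendsto_const_nhds hΩy
    have h3 : Tendsto (fun y' => ‖y' - y₀‖) (𝓝 y) (𝓝 ‖y - y₀‖) :=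
      ((continuous_id.sub continuous_const).norm).tendsto y
    exact (h1.eventually_const_lt hyA).and ((h3.eventually_lt_const hyρ).and
      (h2.eventually_const_lt (by rw [hεS]; linarith)))
  obtain ⟨r, hr, hrP⟩ := Metric.eventually_nhds_iff.mp hnear
  set x₀ : ℕ → EuclideanSpace ℝ (Fin 3) := fun j => xc j + lam j • y₀ with hx₀
  set Phys : ℕ → Set (EuclideanSpace ℝ (Fin 3)) := fun j =>
    {x' : EuclideanSpace ℝ (Fin 3) | lam₀ * ‖ω (t j) (x₀ j)‖ ≤ ‖ω (t j) x'‖ ∧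
      ‖x₀ j - x'‖ ≤ R₀ * Real.sqrt (ν / ‖ω (t j) (x₀ j)‖) ∧
      εS < Real.sqrt (1 - (inner ℝ (‖ω (t j) (x₀ j)‖⁻¹ • ω (t j) (x₀ j))
        (‖ω (t j) x'‖⁻¹ • ω (t j) x')) ^ 2)} with hPhys
  set Aset : ℕ → Set (EuclideanSpace ℝ (Fin 3)) := fun j =>
    {y' : EuclideanSpace ℝ (Fin 3) | xc j + lam j • y' ∈ Phys j} with hAset
  have e1 : ∀ᶠ j in atTop, ‖w j y₀‖ < 2 * A := (hconv' y₀).norm.eventually_lt_const (by linarith)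
  have e2 : ∀ᶠ j in atTop, A / 2 < ‖w j y₀‖ := (hconv' y₀).norm.eventually_const_lt (by linarith)
  have hmem : ∀ y' : EuclideanSpace ℝ (Fin 3), dist y' y < r → ∀ᶠ j in atTop, y' ∈ Aset j := by
    intro y' hy'
    obtain ⟨hP1, hP2, hP3⟩ := hrP hy'
    have hΩy' : Ω y' ≠ 0 := by
      intro h; rw [h, norm_zero] at hP1; nlinarith
    have e3 : ∀ᶠ j in atTop, 0 < ‖w j y'‖ - lam₀ * ‖w j y₀‖ :=
      (((hconv' y').norm).sub (((hconv' y₀).norm).const_mul lam₀)).eventually_const_lt (by linarith)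
    have e4 : ∀ᶠ j in atTop,
        εS < Real.sqrt (1 - (inner ℝ (‖w j y₀‖⁻¹ • w j y₀) (‖w j y'‖⁻¹ • w j y')) ^ 2) :=
      (tendsto_dirSine hy₀ hΩy' (hconv' y₀) (hconv' y')).eventually_const_lt hP3
    filter_upwards [e1, e2, e3, e4] with j h1 h2 h3 h4
    set c := lam j ^ 2 / ν with hcdef
    have hcj : 0 < c := hc j
    set a := ω (t j) (x₀ j) with hadef
    set b := ω (t j) (xc j + lam j • y') with hbdef
    have hwa : w j y₀ = c • a := rfl
    have hwb : w j y' = c • b := rfl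
    have hna : ‖w j y₀‖ = c * ‖a‖ := by rw [hwa, norm_smul, Real.norm_of_nonneg hcj.le]
    have hnb : ‖w j y'‖ = c * ‖b‖ := by rw [hwb, norm_smul, Real.norm_of_nonneg hcj.le]
    show xc j + lam j • y' ∈ Phys j
    refine ⟨?_, ?_, ?_⟩
    · -- relative top set (`λ₀`-comparable)
      rw [hna, hnb] at h3
      have h8 : c * (lam₀ * ‖a‖) < c * ‖b‖ := by nlinarith [h3]
      exact (lt_of_mul_lt_mul_left h8 hcj.le).le
    · -- inside the amplitude ball of radius `R₀ √(ν/|a|)`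
      have hxy : x₀ j - (xc j + lam j • y') = lam j • (y₀ - y') := by
        show (xc j + lam j • y₀) - (xc j + lam j • y') = lam j • (y₀ - y')
        rw [smul_sub]; abel
      rw [hxy, norm_smul, Real.norm_of_nonneg (hlam j).le]
      have hapos : 0 < ‖a‖ := by
        have h0 : 0 < c * ‖a‖ := by rw [← hna]; linarith [h2]
        rcases (norm_nonneg a).lt_or_eq with hp | hz
        · exact hp
        · rw [← hz, mul_zero] at h0; exact absurd h0 (lt_irrefl 0)
      have hq : lam j ^ 2 / (2 * A) ≤ ν / ‖a‖ := by
        rw [div_le_div_iff₀ (by positivity) hapos]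
        have ha2 : c * ‖a‖ < 2 * A := by rw [← hna]; exact h1
        rw [hcdef] at ha2
        have : lam j ^ 2 * ‖a‖ < 2 * A * ν := by
          have := (div_mul_eq_mul_div (lam j ^ 2) ν ‖a‖).symm ▸ ha2
          rwa [div_lt_iff₀ hν] at this
        linarith
      have hsq : lam j / Real.sqrt (2 * A) ≤ Real.sqrt (ν / ‖a‖) := by
        have : Real.sqrt (lam j ^ 2 / (2 * A)) = lam j / Real.sqrt (2 * A) := by
          rw [Real.sqrt_div' _, Real.sqrt_sq (hlam j).le]
          positivity
        rw [← this]; exact Real.sqrt_le_sqrt hq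
      have hyy : ‖y₀ - y'‖ < ρ := by rw [norm_sub_rev]; exact hP2
      calc lam j * ‖y₀ - y'‖ ≤ lam j * (R₀ / Real.sqrt (2 * A)) :=
            mul_le_mul_of_nonneg_left (hyy.le.trans hρle) (hlam j).le
        _ = R₀ * (lam j / Real.sqrt (2 * A)) := by ring
        _ ≤ R₀ * Real.sqrt (ν / ‖a‖) := mul_le_mul_of_nonneg_left hsq hR₀.le
    · -- misaligned
      rw [← dirSine_smul_pos hcj a b, ← hwa, ← hwb]; exact h4
  set Tail : ℕ → Set (EuclideanSpace ℝ (Fin 3)) := fun N => ⋂ j, ⋂ (_ : N ≤ j), Aset j with hTail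
  have hTailmono : Monotone Tail := by
    intro N N' hNN' z hz
    simp only [hTail, mem_iInter] at hz ⊢
    exact fun j hj => hz j (le_trans hNN' hj)
  have hball : Metric.ball y r ⊆ ⋃ N, Tail N := by
    intro y' hy'
    obtain ⟨N, hN⟩ := eventually_atTop.mp (hmem y' (Metric.mem_ball.mp hy'))
    exact mem_iUnion.mpr ⟨N, mem_iInter.mpr fun j => mem_iInter.mpr fun hj => hN j hj⟩
  set V := volume (Metric.ball y r) with hV
  have hVpos : 0 < V := Metric.measure_ball_pos volume y hr
  have hVtop : V ≠ ⊤ := (measure_ball_lt_top).ne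
  have hVreal : 0 < V.toReal := ENNReal.toReal_pos hVpos.ne' hVtop
  set K := Real.sqrt (2 / A) with hK
  have hKpos : 0 < K := Real.sqrt_pos.mpr (by positivity)
  set δ := V.toReal / (2 * K ^ 3) with hδ
  have hδ0 : 0 < δ := by positivity
  set κ : ℝ := A * (-s) / 2 with hκ
  have hκ0 : 0 < κ := by have := neg_pos.2 hs; positivity
  obtain ⟨M, hM0, hM⟩ := hW κ hκ0 εS hεS0 δ hδ0
  have e5 : ∀ᶠ j in atTop, lam j < Real.sqrt (A * ν / (2 * M)) :=
    hlam0.eventually_lt_const (Real.sqrt_pos.mpr (by positivity))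
  have e6 : ∀ᶠ j in atTop, 0 < t j := htT.eventually_const_lt hT
  obtain ⟨N₀, hN₀⟩ := eventually_atTop.mp ((e1.and e2).and (e5.and e6))
  have hAj : ∀ j, N₀ ≤ j → volume (Aset j) ≤ ENNReal.ofReal (V.toReal / 2) := by
    intro j hj
    obtain ⟨⟨h1, h2⟩, h5, h6⟩ := hN₀ j hj
    set c := lam j ^ 2 / ν with hcdef
    have hcj : 0 < c := hc j
    set a := ω (t j) (x₀ j) with hadef
    have hna : ‖w j y₀‖ = c * ‖a‖ := by
      show ‖(lam j ^ 2 / ν) • ω (t j) (xc j + lam j • y₀)‖ = c * ‖a‖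
      rw [norm_smul, Real.norm_of_nonneg hcj.le]
    rw [hna] at h1 h2
    have hTt : 0 < T - t j := sub_pos.2 (ht j).2
    have hlam2 : lam j ^ 2 < A * ν / (2 * M) := by
      have h0 : 0 ≤ lam j := (hlam j).le
      calc lam j ^ 2 = lam j * lam j := by ring
        _ < Real.sqrt (A * ν / (2 * M)) * Real.sqrt (A * ν / (2 * M)) := mul_lt_mul'' h5 h5 h0 h0
        _ = A * ν / (2 * M) := Real.mul_self_sqrt (by positivity)
    have hcle' : c ≤ A / (2 * M) := by
      rw [hcdef, div_le_iff₀ hν]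
      have hr : A / (2 * M) * ν = A * ν / (2 * M) := by ring
      rw [hr]; exact hlam2.le
    have hMa : M ≤ ‖a‖ := by
      have hapos : 0 ≤ ‖a‖ := norm_nonneg _
      have h6' : A / 2 < A / (2 * M) * ‖a‖ := lt_of_lt_of_le h2 (mul_le_mul_of_nonneg_right hcle' hapos)
      have h7 : M * (A / 2) < M * (A / (2 * M) * ‖a‖) := mul_lt_mul_of_pos_left h6' hM0
      have hsimp : M * (A / (2 * M) * ‖a‖) = A / 2 * ‖a‖ := by field_simp
      rw [hsimp] at h7
      have hA2 : 0 < A / 2 := by linarith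
      nlinarith
    have hapos : 0 < ‖a‖ := lt_of_lt_of_le hM0 hMa
    have hκa : κ / (T - t j) ≤ ‖a‖ := by
      rw [div_le_iff₀ hTt, hκ]
      have hTeq : T - t j = lam j ^ 2 * (-s) / ν := by
        rw [hpar j]; field_simp
      rw [hTeq]
      have hs' : 0 < -s := neg_pos.2 hs
      have : A / 2 * (-s) < c * ‖a‖ * (-s) := mul_lt_mul_of_pos_right h2 hs'
      have e : ‖a‖ * (lam j ^ 2 * (-s) / ν) = c * ‖a‖ * (-s) := by rw [hcdef]; ring
      rw [e]
      linarith
    have hphys : volume (Phys j) ≤ ENNReal.ofReal (δ * Real.sqrt (ν / ‖a‖) ^ 3) :=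
      hM (t j) ⟨h6, (ht j).2⟩ (x₀ j) hMa hκa
    have hpre : Aset j = (fun y' : EuclideanSpace ℝ (Fin 3) => lam j • y') ⁻¹'
        ((fun z : EuclideanSpace ℝ (Fin 3) => xc j + z) ⁻¹' Phys j) := rfl
    have hvolA : volume (Aset j) = ENNReal.ofReal ((lam j ^ 3)⁻¹) * volume (Phys j) := by
      rw [hpre, Measure.addHaar_preimage_smul volume (hlam j).ne', finrank_euclideanSpace_fin,
        measure_preimage_add, abs_of_pos (inv_pos.mpr (pow_pos (hlam j) 3))]
    have hsqrt : Real.sqrt (ν / ‖a‖) < lam j * K := by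
      have hq : ν / ‖a‖ < lam j ^ 2 * (2 / A) := by
        rw [div_lt_iff₀ hapos]
        have h6' : A / 2 < lam j ^ 2 / ν * ‖a‖ := h2
        rw [div_mul_eq_mul_div, lt_div_iff₀ hν] at h6'
        have hA' : 0 < 2 / A := by positivity
        have h7 := mul_lt_mul_of_pos_left h6' hA'
        have h8 : 2 / A * (A / 2 * ν) = ν := by field_simp
        rw [h8] at h7
        calc ν < 2 / A * (lam j ^ 2 * ‖a‖) := h7
          _ = lam j ^ 2 * (2 / A) * ‖a‖ := by ring
      calc Real.sqrt (ν / ‖a‖) < Real.sqrt (lam j ^ 2 * (2 / A)) := Real.sqrt_lt_sqrt (by positivity) hq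
        _ = lam j * K := by rw [Real.sqrt_mul (sq_nonneg (lam j)) (2 / A), Real.sqrt_sq (hlam j).le]
    calc volume (Aset j) = ENNReal.ofReal ((lam j ^ 3)⁻¹) * volume (Phys j) := hvolA
      _ ≤ ENNReal.ofReal ((lam j ^ 3)⁻¹) * ENNReal.ofReal (δ * Real.sqrt (ν / ‖a‖) ^ 3) := by gcongr
      _ = ENNReal.ofReal ((lam j ^ 3)⁻¹ * (δ * Real.sqrt (ν / ‖a‖) ^ 3)) :=
          (ENNReal.ofReal_mul (inv_nonneg.mpr (pow_nonneg (hlam j).le 3))).symm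
      _ ≤ ENNReal.ofReal (V.toReal / 2) := by
          apply ENNReal.ofReal_le_ofReal
          have hl3 : 0 < lam j ^ 3 := pow_pos (hlam j) 3
          have hineq : Real.sqrt (ν / ‖a‖) ^ 3 ≤ (lam j * K) ^ 3 :=
            pow_le_pow_left₀ (Real.sqrt_nonneg _) hsqrt.le 3
          calc (lam j ^ 3)⁻¹ * (δ * Real.sqrt (ν / ‖a‖) ^ 3)
              ≤ (lam j ^ 3)⁻¹ * (δ * (lam j * K) ^ 3) := by
                apply mul_le_mul_of_nonneg_left _ (inv_nonneg.mpr hl3.le)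
                exact mul_le_mul_of_nonneg_left hineq hδ0.le
            _ = δ * K ^ 3 := by
                have hl0 : lam j ≠ 0 := (hlam j).ne'
                field_simp
            _ = V.toReal / 2 := by
                have hK0 : K ≠ 0 := hKpos.ne'
                rw [hδ]; field_simp
  have hTailN : ∀ N, volume (Tail N) ≤ ENNReal.ofReal (V.toReal / 2) := by
    intro N
    have hsub : Tail N ⊆ Aset (max N N₀) := by
      intro z hz
      simp only [hTail, mem_iInter] at hz
      exact hz (max N N₀) (le_max_left _ _)
    exact (measure_mono hsub).trans (hAj _ (le_max_right _ _))
  have hU : volume (⋃ N, Tail N) = ⨆ N, volume (Tail N) := hTailmono.measure_iUnion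
  have hle : V ≤ ENNReal.ofReal (V.toReal / 2) :=
    calc V ≤ volume (⋃ N, Tail N) := measure_mono hball
      _ = ⨆ N, volume (Tail N) := hU
      _ ≤ ENNReal.ofReal (V.toReal / 2) := iSup_le hTailN
  have hlt : ENNReal.ofReal (V.toReal / 2) < V := by
    calc ENNReal.ofReal (V.toReal / 2) < ENNReal.ofReal V.toReal :=
          (ENNReal.ofReal_lt_ofReal_iff_of_nonneg (by positivity)).mpr (by linarith)
      _ = V := ENNReal.ofReal_toReal hVtop
  exact absurd hle (not_le.mpr hlt)

/-- **W3ʷᵇ at one solution makes a parabolic vorticity-zoom limit parallel to `Ω y₀` on a window** around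
any `y₀` with `Ω y₀ ≠ 0` (ratio normalised to `max lam0 ½`; localised Fatou upgrade; equality in
Cauchy–Schwarz). [folklore] -/
theorem exists_window_cross_eq_zero_of_windowBulkAligned {ν T : ℝ} (hν : 0 < ν) (hT : 0 < T)
    {ω : ℝ → EuclideanSpace ℝ (Fin 3) → EuclideanSpace ℝ (Fin 3)} {lam0 R0 : ℝ} (hlam01 : lam0 < 1)
    (hR0 : 0 < R0)
    (hW : ∀ κ : ℝ, 0 < κ → ∀ ε : ℝ, 0 < ε → ∀ δ : ℝ, 0 < δ → ∃ M : ℝ, 0 < M ∧ ∀ t ∈ Set.Ico 0 T,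
      ∀ x : EuclideanSpace ℝ (Fin 3), M ≤ ‖ω t x‖ → κ / (T - t) ≤ ‖ω t x‖ →
        volume {y : EuclideanSpace ℝ (Fin 3) | lam0 * ‖ω t x‖ ≤ ‖ω t y‖ ∧
            ‖x - y‖ ≤ R0 * Real.sqrt (ν / ‖ω t x‖) ∧
            ε < Real.sqrt (1 - (inner ℝ (‖ω t x‖⁻¹ • ω t x) (‖ω t y‖⁻¹ • ω t y)) ^ 2)}
          ≤ ENNReal.ofReal (δ * Real.sqrt (ν / ‖ω t x‖) ^ 3))
    {s : ℝ} (hs : s < 0) {xc : ℕ → EuclideanSpace ℝ (Fin 3)} {t : ℕ → ℝ} {lam : ℕ → ℝ}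
    {Ω : EuclideanSpace ℝ (Fin 3) → EuclideanSpace ℝ (Fin 3)}
    (ht : ∀ j, t j ∈ Ico 0 T) (htT : Tendsto t atTop (𝓝 T)) (hlam : ∀ j, 0 < lam j)
    (hlam0 : Tendsto lam atTop (𝓝 0)) (hpar : ∀ j, lam j ^ 2 * (-s) = ν * (T - t j))
    (hΩ : Continuous Ω)
    (hconv : ∀ y, Tendsto (fun j => (lam j ^ 2 / ν) • ω (t j) (xc j + lam j • y)) atTop (𝓝 (Ω y)))
    {y₀ : EuclideanSpace ℝ (Fin 3)} (hy₀ : Ω y₀ ≠ 0) :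
    ∃ U : Set (EuclideanSpace ℝ (Fin 3)), IsOpen U ∧ y₀ ∈ U ∧ ∀ y ∈ U, cross (Ω y) (Ω y₀) = 0 := by
  set lam₀ : ℝ := max lam0 (1 / 2) with hlam₀def
  have hlam₀ : 0 < lam₀ := lt_of_lt_of_le (by norm_num) (le_max_right _ _)
  have hlam₀1 : lam₀ < 1 := max_lt hlam01 (by norm_num)
  have hfam : ∀ κ : ℝ, 0 < κ → ∀ ε : ℝ, 0 < ε → ∀ δ : ℝ, 0 < δ → ∃ M : ℝ, 0 < M ∧ ∀ t ∈ Set.Ioo 0 T,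
      ∀ x : EuclideanSpace ℝ (Fin 3), M ≤ ‖ω t x‖ → κ / (T - t) ≤ ‖ω t x‖ →
        volume {y : EuclideanSpace ℝ (Fin 3) | lam₀ * ‖ω t x‖ ≤ ‖ω t y‖ ∧
            ‖x - y‖ ≤ R0 * Real.sqrt (ν / ‖ω t x‖) ∧
            ε < Real.sqrt (1 - (inner ℝ (‖ω t x‖⁻¹ • ω t x) (‖ω t y‖⁻¹ • ω t y)) ^ 2)}
          ≤ ENNReal.ofReal (δ * Real.sqrt (ν / ‖ω t x‖) ^ 3) := by
    intro κ hκ ε hε δ hδ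
    obtain ⟨M, hM0, hM⟩ := hW κ hκ ε hε δ hδ
    refine ⟨M, hM0, fun t ht x hMx hκx => le_trans (measure_mono fun y hy => ?_)
      (hM t ⟨ht.1.le, ht.2⟩ x hMx hκx)⟩
    obtain ⟨h1, h2, h3⟩ := hy
    exact ⟨le_trans (mul_le_mul_of_nonneg_right (le_max_left _ _) (norm_nonneg _)) h1, h2, h3⟩
  set A := ‖Ω y₀‖ with hAdef
  have hA : 0 < A := norm_pos_iff.mpr hy₀
  set ρ : ℝ := R0 / (2 * Real.sqrt (2 * A)) with hρ
  have hρ0 : 0 < ρ := by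
    have := Real.sqrt_pos.2 (show (0 : ℝ) < 2 * A by linarith); positivity
  refine ⟨{y | lam₀ * A < ‖Ω y‖} ∩ ball y₀ ρ,
    (isOpen_lt continuous_const (continuous_norm.comp hΩ)).inter isOpen_ball,
    ⟨by show lam₀ * A < ‖Ω y₀‖; rw [← hAdef]; nlinarith, mem_ball_self hρ0⟩, fun y hy => ?_⟩
  obtain ⟨hyA, hyball⟩ := hy
  change lam₀ * A < ‖Ω y‖ at hyA
  rw [mem_ball, dist_eq_norm] at hyball
  have hyne : Ω y ≠ 0 := norm_pos_iff.mp (lt_of_le_of_lt (by positivity) hyA)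
  have hsine := dirSine_near_eq_zero_aux hν hT hlam₀ hR0 hfam hs ht htT hlam hlam0 hpar hΩ hconv hy₀
    hyA hyball
  set e := Ω y₀ with hedef
  set b := Ω y with hbdef
  set cc : ℝ := inner ℝ (‖e‖⁻¹ • e) (‖b‖⁻¹ • b) with hcc
  have hc1 : 1 ≤ cc ^ 2 := by
    have := Real.sqrt_eq_zero'.mp hsine
    linarith
  have hne' : ‖e‖ ≠ 0 := norm_ne_zero_iff.mpr hy₀
  have hnb : ‖b‖ ≠ 0 := norm_ne_zero_iff.mpr hyne
  have hcval : cc = (‖e‖⁻¹ * ‖b‖⁻¹) * inner ℝ e b := by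
    rw [hcc, real_inner_smul_left, real_inner_smul_right]; ring
  have hCS : (inner ℝ e b) ^ 2 ≤ ‖e‖ ^ 2 * ‖b‖ ^ 2 := by
    have h1 := abs_real_inner_le_norm e b
    have h2 : 0 ≤ ‖e‖ * ‖b‖ := by positivity
    calc (inner ℝ e b) ^ 2 = |inner ℝ e b| ^ 2 := by rw [sq_abs]
      _ ≤ (‖e‖ * ‖b‖) ^ 2 := by nlinarith [h1, abs_nonneg (inner ℝ e b)]
      _ = ‖e‖ ^ 2 * ‖b‖ ^ 2 := by ring
  have hge : ‖e‖ ^ 2 * ‖b‖ ^ 2 ≤ (inner ℝ e b) ^ 2 := by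
    rw [hcval] at hc1
    have hpos : 0 < ‖e‖ ^ 2 * ‖b‖ ^ 2 := by positivity
    have hrew : ((‖e‖⁻¹ * ‖b‖⁻¹) * inner ℝ e b) ^ 2 = (inner ℝ e b) ^ 2 / (‖e‖ ^ 2 * ‖b‖ ^ 2) := by
      field_simp
    rw [hrew, le_div_iff₀ hpos] at hc1
    linarith
  have heq : (inner ℝ e b) ^ 2 = ‖e‖ ^ 2 * ‖b‖ ^ 2 := le_antisymm hCS hge
  have hr : e = (inner ℝ e b / ‖b‖ ^ 2) • b := by
    have hb2 : ‖b‖ ^ 2 ≠ 0 := pow_ne_zero 2 hnb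
    have h0 : ‖e - (inner ℝ e b / ‖b‖ ^ 2) • b‖ ^ 2 = 0 := by
      rw [norm_sub_sq_real, inner_smul_right, norm_smul, mul_pow, Real.norm_eq_abs, sq_abs]
      field_simp
      linear_combination (-1 : ℝ) * heq
    rw [sq_eq_zero_iff, norm_eq_zero, sub_eq_zero] at h0
    exact h0
  rw [hr]
  ext i
  fin_cases i <;> simp [cross]

/-- **W3ʷᵇ at one solution plus a non-trivial Type-I ancient mild field whose slice vorticities are
parabolic vorticity-zoom limits of that solution is absurd** (the body of `closes` for the door W3ʷᵇ with
the zoom crux in parabolic form = conclusion of `typeIZoom_ancientMild_limit_parabolic`): vorticity-free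
slices ⇒ `unidirectionalVorticityLiouville`; else the window lemma + `eq_zero_of_aligned_window`.
[cite: GigaMiura2011, Thm 1.1 with Rmk 1.4 and §2.1 (HUPS preprint #956 pp. 3–9)] -/
theorem false_of_windowBulkAligned_parabolicZoom {ν T : ℝ} (hν : 0 < ν) (hT : 0 < T)
    {u : ℝ → EuclideanSpace ℝ (Fin 3) → EuclideanSpace ℝ (Fin 3)} {lam0 R0 : ℝ} (hlam01 : lam0 < 1)
    (hR0 : 0 < R0)
    (hW : ∀ κ : ℝ, 0 < κ → ∀ ε : ℝ, 0 < ε → ∀ δ : ℝ, 0 < δ → ∃ M : ℝ, 0 < M ∧ ∀ t ∈ Set.Ico 0 T,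
      ∀ x : EuclideanSpace ℝ (Fin 3), M ≤ ‖curl (u t) x‖ → κ / (T - t) ≤ ‖curl (u t) x‖ →
        volume {y : EuclideanSpace ℝ (Fin 3) | lam0 * ‖curl (u t) x‖ ≤ ‖curl (u t) y‖ ∧
            ‖x - y‖ ≤ R0 * Real.sqrt (ν / ‖curl (u t) x‖) ∧
            ε < Real.sqrt (1 - (inner ℝ (‖curl (u t) x‖⁻¹ • curl (u t) x)
              (‖curl (u t) y‖⁻¹ • curl (u t) y)) ^ 2)}
          ≤ ENNReal.ofReal (δ * Real.sqrt (ν / ‖curl (u t) x‖) ^ 3))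
    {C : ℝ} {W : ℝ → EuclideanSpace ℝ (Fin 3) → EuclideanSpace ℝ (Fin 3)} (hWcl : IsTypeIAncientMild C W)
    (hW0 : W (-1) 0 ≠ 0)
    (hzoom : ∀ s < (0 : ℝ), ∃ (xc : ℕ → EuclideanSpace ℝ (Fin 3)) (t : ℕ → ℝ) (lam : ℕ → ℝ),
      (∀ j, t j ∈ Ico 0 T) ∧ Tendsto t atTop (𝓝 T) ∧ (∀ j, 0 < lam j) ∧
      Tendsto lam atTop (𝓝 0) ∧ (∀ j, lam j ^ 2 * (-s) = ν * (T - t j)) ∧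
      ∀ y, Tendsto (fun j => (lam j ^ 2 / ν) • curl (u (t j)) (xc j + lam j • y)) atTop
        (𝓝 (curl (W s) y))) : False := by
  by_cases hall : ∀ s < (0 : ℝ), ∀ y, curl (W s) y = 0
  · -- every slice vorticity vanishes: parallel to any fixed vector, so Giga–Miura's Liouville applies
    have he : (EuclideanSpace.single (0 : Fin 3) (1 : ℝ) : EuclideanSpace ℝ (Fin 3)) ≠ 0 := by
      intro h
      have := congr_arg (fun v : EuclideanSpace ℝ (Fin 3) => v 0) h
      simp at this
    exact hW0 (unidirectionalVorticityLiouville hWcl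
      (fun s hs => ⟨EuclideanSpace.single 0 1, he, fun y => ⟨0, by rw [hall s hs y, zero_smul]⟩⟩)
      (-1) (by norm_num) 0)
  · push Not at hall
    obtain ⟨s₀, hs₀, y₀, hy₀⟩ := hall
    obtain ⟨xc, t, lam, ht, htT, hlam, hlam0, hpar, hconv⟩ := hzoom s₀ hs₀
    have hcont : Continuous (curl (W s₀)) :=
      continuous_curl ((hWcl.contDiff_slice hs₀).of_le (by exact_mod_cast le_top))
    obtain ⟨U, hUo, hy₀U, hal⟩ := exists_window_cross_eq_zero_of_windowBulkAligned hν hT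
      (ω := fun τ => curl (u τ)) hlam01 hR0 hW hs₀ ht htT hlam hlam0 hpar hcont hconv hy₀
    exact hW0 (eq_zero_of_aligned_window hWcl.hasTypeITimeDecay hWcl.continuousOn_uncurry
      (fun s t hst ht' x => hWcl.mild_eq_heatExtension hst ht' x) (fun t ht' => hWcl.isDivFree ht')
      hs₀ hy₀ hUo ⟨y₀, hy₀U⟩ hal (-1) (by norm_num) 0)
end Summit.NavierStokesRegularity.NavierStokesRegularity.Theorems
end
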